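import Summits.Ventures.CertifiedQuantumChemistry.Rows.CARNormalOrderSound
import HarnessLib

/-!
# The RESIDUAL SPLIT of a collected CAR polynomial: `evalPoly d P = (constCoeff P)·1 + Σ_k aₖ • ladderWord wₖ` with
# `Σ_k ‖aₖ‖ = l1Nonconst P` — the normaliser's leftover IS the residual family `Σ aₖ wₖ` of a window-certificate identity

HONEST FRAMING: Lean plumbing towards «tier P» (replacing a claim node's certificate IDENTITY hypothesis by a kernel computation);
no number, no claim node, nothing discharged; the rows this serves are CONTROL/CALIBRATION stiffness-scale CEILINGS (wording
(xx1)), silent on the presence of superconductivity; not a `T_c` or phase sentence; no summit statement is proved by this file.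
Seat hubbard-obs-p2 (STIFFNESS), `prover-hubbard-obs-p2-g22-0`, zero compute. Companion of `Rows/CARPolyWindowSyntax.lean`.

The tree's window-certificate soundness theorems (`…HubbardNNNHoppingCorrelatorWindowCertificate`, `…TorusLimitCorrelator{,Affine}`)
price an explicit residual family `Σₖ aₖ • ladderWord wₖ` by `−Σ‖aₖ‖` (every ladder word is a contraction). The quantum-chemistry
cell's engine (`CertifiedQuantumChemistry/Rows/CARNormalOrder{,Sound}.lean`) returns a collected polynomial `P` with
`lowerConst P = constCoeff P − ℓ¹(non-unit coefficients)`. This file identifies the two: `resCoeff P k` (the `k`-th coefficient,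
`0` at a unit monomial) and `resWord d P k` (the `k`-th word through the letter map `d`) satisfy
`evalPoly d P = (constCoeff P)·1 + Σ_{k : Fin |P|} resCoeff P k • ladderWord (resWord d P k)` and
`Σ_k ‖resCoeff P k‖ = l1Nonconst P`, hence `constCoeff P − Σ_k ‖resCoeff P k‖ = lowerConst P` — so NO exact identity ever has
to hold: whatever the normaliser leaves over is the residual family, priced by the engine's own `ℓ¹`.
Everything is PROVED (0 sorry). Reference: C. Jansson, D. Chaykin, C. Keil, SIAM J. Numer. Anal. 46 (2008) 180 (rigorous bounds
from inexact certificates) [JanssonChaykinKeil2008]; Bratteli–Robinson II §5.2.2 [BratteliRobinsonII1997].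
-/

namespace Summit.Ventures.CertifiedManyBodySolver

namespace CARPolyWindow

open Summit.Ventures.CertifiedQuantumChemistry Summit.Ventures.CertifiedQuantumChemistry.CARPoly
open Literature.MathematicalPhysics.QuantumLattice
open Matrix
open scoped ComplexOrder BigOperators

/-! ## The residual split of a polynomial -/

section Residual

variable {α : Type*} {ι : Type*} [LinearOrder ι] [Fintype ι]

/-- The `k`-th residual coefficient of a polynomial: its coefficient, or `0` at a unit monomial. [folklore] -/
def resCoeff (P : CARPoly.Poly α) (k : Fin P.length) : ℂ := if (P.get k).1.isUnit then 0 else (((P.get k).2 : ℚ) : ℂ)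

/-- The `k`-th residual word of a polynomial (through the letter map `d`). [folklore] -/
def resWord (d : α → ι) (P : CARPoly.Poly α) (k : Fin P.length) : List (ι × Bool) := wmap d (P.get k).1.word

/-- `constCoeff` as a plain list sum. [folklore] -/
theorem constCoeff_eq_sum (P : CARPoly.Poly α) : constCoeff P = (P.map CARPoly.constPart).sum := by
  induction P with
  | nil => simp [constCoeff]
  | cons mq P ih => rw [constCoeff_cons, ih, List.map_cons, List.sum_cons]

/-- `l1Nonconst` as a plain list sum. [folklore] -/
theorem l1Nonconst_eq_sum (P : CARPoly.Poly α) : l1Nonconst P = (P.map CARPoly.l1Part).sum := by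
  induction P with
  | nil => simp [l1Nonconst]
  | cons mq P ih => rw [l1Nonconst_cons, ih, List.map_cons, List.sum_cons]

/-- **THE RESIDUAL SPLIT.** `evalPoly d P = (constCoeff P)·1 + Σ_k resCoeff P k • ladderWord (resWord d P k)`.
[cite: JanssonChaykinKeil2008, §3] -/
theorem evalPoly_eq_const_add_residual (d : α → ι) (P : CARPoly.Poly α) :
    evalPoly d P = (((constCoeff P : ℚ)) : ℂ) • (1 : Matrix (Finset ι) (Finset ι) ℂ) +
      ∑ k : Fin P.length, resCoeff P k • ladderWord (resWord d P k) := by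
  induction P with
  | nil => simp [constCoeff]
  | cons mq P ih =>
    rw [evalPoly_cons, ih, constCoeff_cons]
    show _ = _ + ∑ k : Fin (P.length + 1), resCoeff (mq :: P) k • ladderWord (resWord d (mq :: P) k)
    rw [Fin.sum_univ_succ]
    have h0 : resCoeff (mq :: P) 0 • ladderWord (resWord d (mq :: P) 0) =
        (if mq.1.isUnit then (0 : ℂ) else ((mq.2 : ℚ) : ℂ)) • ladderWord (wmap d mq.1.word) := rfl
    have hs : ∀ i : Fin P.length, resCoeff (mq :: P) i.succ • ladderWord (resWord d (mq :: P) i.succ) =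
        resCoeff P i • ladderWord (resWord d P i) := fun i => rfl
    rw [h0, Finset.sum_congr rfl fun i _ => hs i, CARPoly.constPart]
    by_cases hu : mq.1.isUnit = true
    · rw [if_pos hu, if_pos hu, zero_smul, zero_add, (Mono.isUnit_eq_true_iff _).1 hu, evalMono_unit, Rat.cast_add,
        add_smul]
      abel
    · rw [if_neg hu, if_neg hu, zero_add]
      have : evalMono d mq.1 = ladderWord (wmap d mq.1.word) := rfl
      rw [this]
      abel

/-- **The residual price is the engine's `ℓ¹`**: `Σ_k ‖resCoeff P k‖ = l1Nonconst P`. [cite: JanssonChaykinKeil2008, §3] -/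
theorem sum_norm_resCoeff (P : CARPoly.Poly α) : ∑ k : Fin P.length, ‖resCoeff P k‖ = ((l1Nonconst P : ℚ) : ℝ) := by
  induction P with
  | nil => simp [l1Nonconst]
  | cons mq P ih =>
    rw [l1Nonconst_cons]
    show ∑ k : Fin (P.length + 1), ‖resCoeff (mq :: P) k‖ = _
    rw [Fin.sum_univ_succ]
    have h0 : resCoeff (mq :: P) 0 = (if mq.1.isUnit then (0 : ℂ) else ((mq.2 : ℚ) : ℂ)) := rfl
    have hs : ∀ i : Fin P.length, resCoeff (mq :: P) i.succ = resCoeff P i := fun i => rfl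
    rw [h0, Finset.sum_congr rfl fun i _ => by rw [hs i], ih, CARPoly.l1Part]
    by_cases hu : mq.1.isUnit = true
    · rw [if_pos hu, if_pos hu, norm_zero, Rat.cast_add, Rat.cast_zero]
    · rw [if_neg hu, if_neg hu, Rat.cast_add, Rat.cast_abs, ← Complex.ofReal_ratCast, Complex.norm_real, Real.norm_eq_abs]

/-- Hence `constCoeff P − Σ_k ‖resCoeff P k‖ = lowerConst P`. [cite: JanssonChaykinKeil2008, §3] -/
theorem constCoeff_sub_sum_norm_resCoeff (P : CARPoly.Poly α) :
    ((constCoeff P : ℚ) : ℝ) - ∑ k : Fin P.length, ‖resCoeff P k‖ = ((lowerConst P : ℚ) : ℝ) := by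
  rw [sum_norm_resCoeff, lowerConst, Rat.cast_sub]

end Residual

end CARPolyWindow

end Summit.Ventures.CertifiedManyBodySolver
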